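import Summits.CriticalPhenomena.PercolationContinuityZ3.Theses.PercNonProliferation
import Summits.CriticalPhenomena.PercolationContinuityZ3.Theorems.NonProliferation.Negative.AboveSix
import HarnessLib

/-!
# Crux `PercNonProliferation.NonProliferation` (stmt-CriticalPhenomena-4444), line `boundary-pinning` — stub `stub_cellUnionBound`

Helper file for the lead's skeleton of line `boundary-pinning` (payload slug `Sketch`,
`Cruxes/NonProliferation/Lines/…`, prover-line-stmt-CriticalPhenomena-4444-c1).
Proves exactly the registered stub signature `stub_cellUnionBound`; lands with
`--supports stmt-CriticalPhenomena-4444`.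

The first (deterministic + union-bound) lemma of boundary pinning, in every dimension `d`, at every
scale `n` and every edge density `p`: if a finite family `𝒬` of cells covers the inner vertex
boundary `∂ⁱⁿB(2n)` and `ω ∈ repEvent d 𝒬.card n` (there are `#𝒬 + 1` points of `B(n)`, each joined
inside `B(2n)` to `∂ⁱⁿB(2n)`, pairwise NOT joined inside `B(2n)`), then by PIGEONHOLE two of the
boundary endpoints lie in the same cell `Q ∈ 𝒬`, which is the boundary two-distinct-cluster event at
`Q` (`StubCellUnionBound.cell_pigeonhole`: `u, v ∈ Q`, each joined inside `B(2n)` to `B(n)`, `u` not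
joined to `v` inside `B(2n)` — else the two representatives would be joined, by symmetry/transitivity
of `{· ↔ · in S}`). The UNION BOUND (`measureReal_biUnion_finset_le`) then gives
`P_p(repEvent d #𝒬 n) ≤ Σ_{Q ∈ 𝒬} P_p(faceTwoArm n Q)`.
Adapted from ideator 5's kernel-checked `cell_pigeonhole` / `cellUnionBound`
(`Cruxes/NonProliferation/Sketch_ideator5.lean`, `d = 3`, critical measure), generalised to every
`d` and `p`.
-/

noncomputable section

namespace Summit.CriticalPhenomena.PercolationContinuityZ3.Theorems.NonProliferation

open MeasureTheory Filter Topology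
open Literature.Probability.LatticeModels Literature.Probability.Percolation
open Summit.CriticalPhenomena.PercolationContinuityZ3.Theorems.NonProliferation.Negative

namespace StubCellUnionBound

/-- **Pigeonhole.** If a finite family `𝒬` of cells covers the inner vertex boundary `∂ⁱⁿB(2n)` and
`ω` has `#𝒬 + 1` pairwise box-unjoined representatives in `B(n)`, each joined inside `B(2n)` to
`∂ⁱⁿB(2n)`, then two of the boundary endpoints lie in one cell `Q ∈ 𝒬`: the boundary
two-distinct-cluster event holds at `Q`. -/
theorem cell_pigeonhole (d n : ℕ) (𝒬 : Finset (Finset (Site d)))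
    (hcov : ∀ y ∈ innerBoundary (zdGraph d) (box d (2 * n)), ∃ Q ∈ 𝒬, y ∈ Q)
    (ω : BondConfig (Site d)) (h : ω ∈ repEvent d 𝒬.card n) :
    ∃ Q ∈ 𝒬, ∃ u ∈ Q, ∃ v ∈ Q,
      (∃ a ∈ box d n, ω ∈ openConnIn (↑(box d (2 * n)) : Set (Site d)) u a) ∧
      (∃ b ∈ box d n, ω ∈ openConnIn (↑(box d (2 * n)) : Set (Site d)) v b) ∧
      ω ∉ openConnIn (↑(box d (2 * n)) : Set (Site d)) u v := by
  classical
  obtain ⟨x, hx, hconn, hdisj⟩ := h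
  choose y hy hxy using hconn
  choose Q hQ hyQ using fun i => hcov (y i) (hy i)
  -- pigeonhole: `#𝒬 + 1` indices, `#𝒬` cells
  obtain ⟨i, j, hij, hQij⟩ : ∃ i j : Fin (𝒬.card + 1), i ≠ j ∧ Q i = Q j := by
    have hlt : Fintype.card (𝒬 : Set (Finset (Site d))) < Fintype.card (Fin (𝒬.card + 1)) := by
      simp
    obtain ⟨i, j, hij, h⟩ :=
      Fintype.exists_ne_map_eq_of_card_lt (fun i => (⟨Q i, hQ i⟩ : (𝒬 : Set (Finset (Site d))))) hlt
    exact ⟨i, j, hij, congrArg Subtype.val h⟩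
  -- symmetry / transitivity of `{a ↔ b in B(2n)}` (cf. `GM.openConnIn_comm` / `GM.openConnIn_trans`)
  have hsymm : ∀ {a b : Site d}, ω ∈ openConnIn (↑(box d (2 * n)) : Set (Site d)) a b →
      ω ∈ openConnIn (↑(box d (2 * n)) : Set (Site d)) b a :=
    fun ⟨ha, hb, hab⟩ => ⟨hb, ha, hab.symm⟩
  have htrans : ∀ {a b c : Site d}, ω ∈ openConnIn (↑(box d (2 * n)) : Set (Site d)) a b →
      ω ∈ openConnIn (↑(box d (2 * n)) : Set (Site d)) b c →
      ω ∈ openConnIn (↑(box d (2 * n)) : Set (Site d)) a c :=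
    fun ⟨ha, _, hab⟩ ⟨_, hc, hbc⟩ => ⟨ha, hc, hab.trans hbc⟩
  refine ⟨Q i, hQ i, y i, hyQ i, y j, hQij ▸ hyQ j, ⟨x i, hx i, hsymm (hxy i)⟩,
    ⟨x j, hx j, hsymm (hxy j)⟩, ?_⟩
  intro hyy
  exact hdisj i j hij (htrans (htrans (hxy i) hyy) (hsymm (hxy j)))

end StubCellUnionBound

/-- **Stub `stub_cellUnionBound`** of line `boundary-pinning` (crux stmt-CriticalPhenomena-4444): in
every dimension `d`, at every scale `n` and edge density `p`, if a finite family `𝒬` of cells covers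
`∂ⁱⁿB(2n)`, then `P_p(repEvent d #𝒬 n) ≤ Σ_{Q ∈ 𝒬} P_p(faceTwoArm n Q)`: pigeonhole on the boundary
endpoints of the `#𝒬 + 1` representatives (`StubCellUnionBound.cell_pigeonhole`), then the union
bound `measureReal_biUnion_finset_le`. -/
theorem stub_cellUnionBound :
    ∀ (d n : ℕ) (p : unitInterval) (𝒬 : Finset (Finset (Site d))),
      (∀ y ∈ innerBoundary (zdGraph d) (box d (2 * n)), ∃ Q ∈ 𝒬, y ∈ Q) →
      (bondPercolation (zdGraph d) p).real (repEvent d 𝒬.card n) ≤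
        ∑ Q ∈ 𝒬, (bondPercolation (zdGraph d) p).real
          {ω | ∃ u ∈ Q, ∃ v ∈ Q, (∃ a ∈ box d n, ω ∈ openConnIn (↑(box d (2 * n)) : Set (Site d)) u a) ∧
            (∃ b ∈ box d n, ω ∈ openConnIn (↑(box d (2 * n)) : Set (Site d)) v b) ∧
            ω ∉ openConnIn (↑(box d (2 * n)) : Set (Site d)) u v} := by
  intro d n p 𝒬 hcov
  calc (bondPercolation (zdGraph d) p).real (repEvent d 𝒬.card n)
      ≤ (bondPercolation (zdGraph d) p).real (⋃ Q ∈ 𝒬,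
          {ω | ∃ u ∈ Q, ∃ v ∈ Q, (∃ a ∈ box d n, ω ∈ openConnIn (↑(box d (2 * n)) : Set (Site d)) u a) ∧
            (∃ b ∈ box d n, ω ∈ openConnIn (↑(box d (2 * n)) : Set (Site d)) v b) ∧
            ω ∉ openConnIn (↑(box d (2 * n)) : Set (Site d)) u v}) := by
        refine measureReal_mono (fun ω hω => ?_) (measure_ne_top _ _)
        obtain ⟨Q, hQ, hω'⟩ := StubCellUnionBound.cell_pigeonhole d n 𝒬 hcov ω hω
        exact Set.mem_biUnion hQ hω'
    _ ≤ ∑ Q ∈ 𝒬, (bondPercolation (zdGraph d) p).real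
          {ω | ∃ u ∈ Q, ∃ v ∈ Q, (∃ a ∈ box d n, ω ∈ openConnIn (↑(box d (2 * n)) : Set (Site d)) u a) ∧
            (∃ b ∈ box d n, ω ∈ openConnIn (↑(box d (2 * n)) : Set (Site d)) v b) ∧
            ω ∉ openConnIn (↑(box d (2 * n)) : Set (Site d)) u v} :=
        measureReal_biUnion_finset_le _ _

end Summit.CriticalPhenomena.PercolationContinuityZ3.Theorems.NonProliferation

end
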